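import Summits.FinalStateConjecture.FinalStateConjecture.Theorems.SwallowTheDatumKerrShieldedSettlesStubKerrLeafSojourn
import Literature.Geometry.Lorentzian.KerrData
import HarnessLib

/-!
# `NearExtremalKappaCapture`, line `unit-temperature-front-face` — stub F1 `stub_kerrFlatLeafOptics`:
# sojourn optics of the ingoing Kerr–Schild chart seen from the flat leaf `{t* = 0}`

Support file for crux `stmt-FinalStateConjecture-10606`
(`Summit.FinalStateConjecture.FinalStateConjecture.Theses.PhaseMixingCapture.NearExtremalKappaCapture`): the
registered stub `stub_kerrFlatLeafOptics` — for `0 ≤ M`, `|a| < M` and a future unit normal field `ν` of the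
flat slice embedding `Kerr.sliceEmbed a M : y ↦ (0, y)` of `Kerr.slice a M = {r > M}`, for every `s > 0` there
is `R₁` (`= 21 s + 53M + |a| + 1`) such that every normalised future null ray `γ` of `Kerr.smoothMetric M a M`
from a slice point of Kerr–Schild radius `≥ R₁` is future complete in the chart (`[0, ∞) ⊆ dom`) or spends
affine time `≥ s` in `J⁺(sliceEmbed{8M ≤ ‖y′‖ ≤ 10M})`.

This is the flat-leaf (`T ≡ 0`, inner radius `r₁ = M`) port of the landed bent-leaf theorem
`SwallowTheDatum.KerrShieldedSettles.stub_kerrLeafSojourn`; the generic ray facts of that file and its parts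
1–3 (conserved Killing energy `ray_energy_eq`, far bounds `ray_far_bounds`, escape `Ici_subset_of_far`, first
exit `exists_first_exit`, heredity `mem_causalFuture_of_le`, timelike chart segments
`mem_causalFuture_of_segment`) are reused verbatim at `r₁ = M`.  Only the two leaf-specific pieces are
re-proved here:

* `flat_leaf_cone_mem_causalFuture` (**the explicit region**): every chart point `x` with `‖x⃗‖ ≥ 10M` and
  `x⁰ ≥ 2‖x⃗‖ − 14M` lies in `J⁺(sliceEmbed{8M ≤ ‖y′‖ ≤ 10M})` — the chart segment from the flat leaf point
  `(0, y₀)`, `y₀ = (10M/‖x⃗‖) x⃗`, `‖y₀‖ = 10M`, to `x` has chart slope `≤ 1/2` and stays in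
  `{‖·‖ ≥ 10M} ⊆ {r ≥ 9M}`, where such directions are timelike (`bilin_self_neg_of_cone`);
* `flat_energy_pos_le_five`: for a future unit normal field `ν` of the flat leaf and a null `w` at a leaf
  point of spatial radius `≥ 16M + |a| + 1` normalised by `g(w, ν) = −1`, `0 < −g(w, ∂_{t*}) ≤ 5` whenever
  `w⁰ > 0` (`ks_energy_pinning` with `dh = 0`, `H ≤ 1/16`).

With these, the banking argument (`flat_exists_banked_interval`, banking function `f = t* − 2‖x⃗‖ + 14M`,
intermediate value theorem) and the assembly are those of the template.

References: Dafermos–Rodnianski arXiv:0811.0354, §5.1; Christodoulou, CQG 16 (1999) A23, pp. A26–A27;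
Cook, Living Rev. Relativ. 3 (2000), §3.2.2; O'Neill 1983, Ch. 5, Lemma 8, Ch. 14, p. 402.
-/

set_option linter.dupNamespace false

noncomputable section

open Set Filter MeasureTheory
open scoped Manifold ContDiff Topology
open Literature.Geometry.Lorentzian
open Summit.FinalStateConjecture.FinalStateConjecture.Theorems.KerrShieldedDataExist.Negative (mass_pos)
open Summit.FinalStateConjecture.FinalStateConjecture.Theorems.StarvedNecks.OneOverDelta.FarEnd
  (ks_apply_basisVector_zero ks_energy_pinning)
open Summit.FinalStateConjecture.FinalStateConjecture.Theorems.SwallowTheDatum.KerrShieldedSettles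
open Summit.FinalStateConjecture.FinalStateConjecture.Theorems.SwallowTheDatum.KerrShieldedSettles.KerrLeafSojourn

namespace Summit.FinalStateConjecture.FinalStateConjecture.Theorems.NearExtremalKappaCapture.UnitTemperatureFrontFace

namespace KerrFlatLeaf

/-! ## The explicit region `{‖x⃗‖ ≥ 10M, x⁰ ≥ 2‖x⃗‖ − 14M} ⊆ J⁺(sliceEmbed{8M ≤ ‖y′‖ ≤ 10M})` -/

section Cone

variable [Kerr.Facts] {M a : ℝ}

/-- **The explicit region of `J⁺` of the compact flat leaf piece.** For `|a| < M`, every point `x` of the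
chart `Kerr.region a M` with `‖x⃗‖ ≥ 10M` and `x⁰ ≥ 2‖x⃗‖ − 14M` lies in the causal future of
`sliceEmbed{8M ≤ ‖y′‖ ≤ 10M}`: it is the endpoint of the chart segment from the flat leaf point
`(0, y₀)`, `y₀ = (10M/‖x⃗‖) x⃗` (`‖y₀‖ = 10M`, `r(0, y₀) ≥ 9M > M`), of chart slope `≤ 1/2`, inside
`{r ≥ 9M}` where such directions are future timelike. [cite: ONeillSemiRiemannian1983, Ch. 14, p. 402] -/
theorem flat_leaf_cone_mem_causalFuture (ha : |a| < M) (hM : 0 ≤ M) (x : Kerr.region a M)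
    (hρ : 10 * M ≤ E4.spatialNorm x) (hx0 : 2 * E4.spatialNorm x - 14 * M ≤ (x : E4) 0) :
    x ∈ (Kerr.smoothMetric M a M).causalFuture ((Kerr.timeOrientation M a M hM).ofLE le_top)
      (Kerr.sliceEmbed a M '' {y' : Kerr.slice a M | 8 * M ≤ ‖(y' : E3)‖ ∧ ‖(y' : E3)‖ ≤ 10 * M}) := by
  -- adapted from `KerrLeafSojourn.leaf_cone_mem_causalFuture` (bent leaf), with height `0`
  have hMp := mass_pos ha
  set ρ := E4.spatialNorm x with hρ_def
  have hρ0 : 0 < ρ := by linarith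
  set sx : E3 := E4.spatial (x : E4) with hsx
  have hsxn : ‖sx‖ = ρ := rfl
  set k : ℝ := 10 * M / ρ with hk
  have hk0 : 0 < k := by positivity
  have hk1 : k ≤ 1 := by rw [hk, div_le_one hρ0]; exact hρ
  set y₀ : E3 := k • sx with hy₀
  have hy₀n : ‖y₀‖ = 10 * M := by
    rw [hy₀, norm_smul, Real.norm_eq_abs, abs_of_pos hk0, hsxn, hk, div_mul_cancel₀ _ hρ0.ne']
  -- the flat leaf point over `y₀`
  have hy₀r' : 9 * M ≤ Kerr.radius a (E4.ofTimeSpace 0 y₀) := by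
    have := spatialNorm_sub_le_radius a (E4.ofTimeSpace 0 y₀)
    rw [E4.spatialNorm_ofTimeSpace, hy₀n] at this
    linarith [ha.le]
  have hy₀s : y₀ ∈ Kerr.slice a M := by
    rw [Kerr.mem_slice, max_eq_left hM]; linarith
  have hy₀S : (⟨y₀, hy₀s⟩ : Kerr.slice a M) ∈
      {y' : Kerr.slice a M | 8 * M ≤ ‖(y' : E3)‖ ∧ ‖(y' : E3)‖ ≤ 10 * M} := by
    change 8 * M ≤ ‖y₀‖ ∧ ‖y₀‖ ≤ 10 * M
    rw [hy₀n]
    constructor <;> linarith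
  set p : Kerr.region a M := Kerr.sliceEmbed a M ⟨y₀, hy₀s⟩ with hp
  have hpS : p ∈ Kerr.sliceEmbed a M ''
      {y' : Kerr.slice a M | 8 * M ≤ ‖(y' : E3)‖ ∧ ‖(y' : E3)‖ ≤ 10 * M} :=
    ⟨⟨y₀, hy₀s⟩, hy₀S, rfl⟩
  have hpE : (p : E4) = E4.ofTimeSpace 0 y₀ := rfl
  -- the direction of the segment
  set w : E4 := (x : E4) - p with hw
  have hw0 : w 0 = (x : E4) 0 := by simp [hw, hpE]
  have hws : E4.spatial w = (1 - k) • sx := by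
    rw [hw, map_sub, hpE, E4.spatial_ofTimeSpace, hy₀, ← hsx, sub_smul, one_smul]
  have hwsn : ‖E4.spatial w‖ = ρ - 10 * M := by
    rw [hws, norm_smul, Real.norm_eq_abs, abs_of_nonneg (by linarith), hsxn, hk, sub_mul,
      div_mul_cancel₀ _ hρ0.ne', one_mul]
  have hw0ge : 2 * (ρ - 10 * M) ≤ w 0 := by rw [hw0]; linarith
  have hpos : 0 < w 0 := by rw [hw0]; linarith
  refine LorentzianMetric.causalFuture_mono (singleton_subset_iff.2 hpS) ?_
  -- the segment from `p` to `x`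
  refine mem_causalFuture_of_segment hM p x (fun σ hσ ↦ ?_) (fun σ hσ ↦ ?_) hpos
  all_goals
    have hsp : E4.spatial ((p : E4) + σ • w) = (k + σ * (1 - k)) • sx := by
      rw [map_add, map_smul, hws, hpE, E4.spatial_ofTimeSpace, hy₀, smul_smul, ← add_smul]
    have hcoef : k ≤ k + σ * (1 - k) := by nlinarith [hσ.1, hk1]
    have hnorm : 10 * M ≤ E4.spatialNorm ((p : E4) + σ • w) := by
      rw [E4.spatialNorm, hsp, norm_smul, Real.norm_eq_abs, abs_of_nonneg (by linarith), hsxn]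
      calc 10 * M = k * ρ := by rw [hk, div_mul_cancel₀ _ hρ0.ne']
        _ ≤ (k + σ * (1 - k)) * ρ := mul_le_mul_of_nonneg_right hcoef hρ0.le
    have hr9 : 9 * M ≤ Kerr.radius a ((p : E4) + σ • w) := by
      linarith [spatialNorm_sub_le_radius a ((p : E4) + σ • w), ha.le]
  · exact mem_region_of_norm hM (by linarith [ha.le])
  · have hx' : 0 < Kerr.radius a ((p : E4) + σ • w) := by linarith
    refine bilin_self_neg_of_cone hM a hx' (by linarith) hpos ?_
    rw [← E4.spatialNorm_sq, show E4.spatialNorm w = ‖E4.spatial w‖ from rfl, hwsn]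
    nlinarith

end Cone

/-! ## The normalisation against the flat leaf normal pins the Killing energy -/

section Energy

variable [Kerr.Facts] {M a : ℝ}

/-- **`0 < E ≤ 5` for normalised rays from the far flat leaf.** Let `ν` be a future unit normal field of
the flat slice embedding `sliceEmbed a M` (`|a| < M`), `y` a slice point of spatial radius
`‖y‖ ≥ 16M + |a| + 1`, and `w` a `g`-null vector at `(0, y)` with `w⁰ > 0` normalised by `g(w, ν y) = −1`.
Then its Killing energy `E = −g(w, ∂_{t*})` satisfies `0 < E ≤ 5` (`ks_energy_pinning` with
`d(sliceEmbed) v = (0, v)`, i.e. `dh = 0`, and `H ≤ 1/16`; `g(ν, ∂_{t*}) < 0` by the timecone lemma).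
Cook, Living Rev. Relativ. 3 (2000), §3.2.2. [cite: Cook2000, §3.2.2] -/
theorem flat_energy_pos_le_five (ha : |a| < M) (hM : 0 ≤ M)
    {ν : NormalField 𝓘(ℝ, E4) (Kerr.sliceEmbed a M)}
    (hν : (Kerr.smoothMetric M a M).IsFutureUnitNormal 𝓘(ℝ, E3)
      ((Kerr.timeOrientation M a M hM).ofLE le_top) (Kerr.sliceEmbed a M) ν)
    (y : Kerr.slice a M) (hy : 16 * M + |a| + 1 ≤ ‖(y : E3)‖) {w : E4}
    (hnull : Kerr.bilin M a (Kerr.sliceEmbed a M y) w w = 0) (hw0 : 0 < w 0)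
    (hnorm : Kerr.bilin M a (Kerr.sliceEmbed a M y) w (ν y) = -1) :
    0 < -Kerr.bilin M a (Kerr.sliceEmbed a M y) w (E4.basisVector 0) ∧
      -Kerr.bilin M a (Kerr.sliceEmbed a M y) w (E4.basisVector 0) ≤ 5 := by
  -- adapted from `KerrLeafSojourn.energy_pos_le_five` (bent leaf), with `dh = 0`
  set x : E4 := (Kerr.sliceEmbed a M y : E4) with hx_def
  have hx : 0 < Kerr.radius a x := Kerr.radius_pos_of_mem_region (Kerr.sliceEmbed a M y).2
  obtain ⟨-, hHall, -⟩ := far_leaf_numerics (M := M) ha hy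
  have hH : Kerr.scalarH M a x ≤ 1 / 16 := by
    rw [hx_def, Kerr.coe_sliceEmbed]; exact hHall 0
  -- positivity of the energy from the pinch `(1 − 4H) w⁰ ≤ E`
  have hE : 0 < -Kerr.bilin M a x w (E4.basisVector 0) := by
    have h1 := (energy_pinch hM a hx hnull.le hw0.le).1
    nlinarith
  refine ⟨hE, ?_⟩
  -- the normal in the form consumed by `ks_energy_pinning` (`dh = 0`)
  have hN1 : ∀ q : E3, Kerr.bilin M a x (ν y) (E4.ofTimeSpace ((0 : E3 →L[ℝ] ℝ) q) q) = 0 := by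
    intro q
    have h := hν.1.1 y q
    rw [Kerr.smoothMetric_val, Kerr.mfderiv_sliceEmbed] at h
    rw [_root_.zero_apply, ← E4.spaceEmbed_apply]
    exact h
  have hN2 : Kerr.bilin M a x (ν y) (ν y) = -1 := hν.1.2 y
  have hVν : Kerr.bilin M a x (Kerr.timeVector M a x) (ν y) < 0 := (hν.2 y).2
  have hN3 : Kerr.bilin M a x (ν y) (E4.basisVector 0) < 0 := by
    refine CollarCauchy.bilin_neg_of_cone hM hx (by rw [hN2]; norm_num) hVν ?_ ?_ ?_
    · have hb : (E4.basisVector 0 : E4) 0 = 1 := by simp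
      rw [ks_apply_basisVector_zero, Kerr.nullCovector_basisVector_zero, hb]
      linarith
    · intro h
      have := congrArg (fun v : E4 ↦ v 0) h
      simp at this
    · rw [Kerr.bilin_timeVector hx]
      simp
  have hdh : ‖(0 : E3 →L[ℝ] ℝ)‖ ≤ 1 / 6 := by rw [norm_zero]; norm_num
  exact ks_energy_pinning hM hx hH hdh hN1 hN2 hN3 hnull hnorm hE

end Energy

/-! ## Banking the sojourn of a ray from the far flat leaf -/

section Main

variable [Kerr.Facts] {M a : ℝ} [(Kerr.smoothMetric M a M).HasLeviCivita]
  {γ : ℝ → Kerr.region a M} {dom : Set ℝ}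

/-- **Banking the sojourn (flat leaf).** Let the null geodesic `γ` of the chart `Kerr.region a M` (energy
`E ∈ (0, 5]`, future directed at `0`) start at the flat leaf point `(0, y)` with
`‖y‖ ≥ 21 s + 53M + |a| + 1` and stay in `{r ≥ 16M}` on `[0, l₁] ⊆ dom`, `l₁ > 0`, with `r(γ l₁) = 16M`.
Then there is `lₑ ∈ [0, l₁]` with `l₁ − lₑ ≥ s` such that `γ t ∈ J⁺(sliceEmbed{8M ≤ ‖y′‖ ≤ 10M})` for all
`t ∈ [lₑ, l₁]`: the banking function `f = t* − 2‖x⃗‖ + 14M` is `< 0` at `0` and `> 0` at `l₁`, vanishes at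
some `lₑ` (intermediate value theorem) where the ray is in the explicit region
`{x⁰ ≥ 2‖x⃗‖ − 14M, ‖x⃗‖ ≥ 10M}`, `J⁺` is hereditary along the ray, and `f(l₁) ≤ 21 (l₁ − lₑ)` while
`f(l₁) ≥ ‖y‖ − 37M`. [cite: arXiv08110354, §5.1] -/
theorem flat_exists_banked_interval (ha : |a| < M) (hM : 0 ≤ M) (hopen : IsOpen dom)
    (hoc : dom.OrdConnected) (hgeo : IsGeodesicOn (Kerr.smoothMetric M a M).leviCivita γ dom)
    (h0 : (0 : ℝ) ∈ dom)
    (hnull : Kerr.bilin M a (γ 0) (deriv (fun σ ↦ (γ σ : E4)) 0) (deriv (fun σ ↦ (γ σ : E4)) 0) = 0)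
    (hfd : 0 < deriv (fun σ ↦ (γ σ : E4)) 0 0)
    (hE : 0 < -Kerr.bilin M a (γ 0) (deriv (fun σ ↦ (γ σ : E4)) 0) (E4.basisVector 0))
    (hE5 : -Kerr.bilin M a (γ 0) (deriv (fun σ ↦ (γ σ : E4)) 0) (E4.basisVector 0) ≤ 5)
    {y : Kerr.slice a M} (hγ0 : γ 0 = Kerr.sliceEmbed a M y) {s : ℝ} (hs : 0 < s)
    (hy : 21 * s + 53 * M + |a| + 1 ≤ ‖(y : E3)‖) {l₁ : ℝ} (hl₁0 : 0 < l₁) (hI : Icc 0 l₁ ⊆ dom)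
    (hrl₁ : Kerr.radius a (γ l₁) = 16 * M) (hfarI : ∀ t ∈ Icc 0 l₁, 16 * M ≤ Kerr.radius a (γ t)) :
    ∃ lₑ ∈ Icc 0 l₁, s ≤ l₁ - lₑ ∧ ∀ t ∈ Icc lₑ l₁,
      γ t ∈ (Kerr.smoothMetric M a M).causalFuture ((Kerr.timeOrientation M a M hM).ofLE le_top)
        (Kerr.sliceEmbed a M ''
          {y' : Kerr.slice a M | 8 * M ≤ ‖(y' : E3)‖ ∧ ‖(y' : E3)‖ ≤ 10 * M}) := by
  -- adapted from `KerrLeafSojourn.exists_banked_interval` (bent leaf), with start height `0`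
  have hMp := mass_pos ha
  have habs : 0 ≤ |a| := abs_nonneg a
  have hs21 : 0 ≤ 21 * s := by positivity
  -- kinematics on `[0, l₁]`
  have hIoc : (Icc (0 : ℝ) l₁).OrdConnected := ordConnected_Icc
  have hder : ∀ t ∈ Icc 0 l₁, HasDerivAt (fun σ ↦ (γ σ : E4)) (deriv (fun σ ↦ (γ σ : E4)) t) t :=
    fun t ht ↦ (ray_hasDerivAt hgeo (hI ht)).1
  have hfb : ∀ t ∈ Icc 0 l₁, 0 < deriv (fun σ ↦ (γ σ : E4)) t 0 ∧
      ‖E4.spatial (deriv (fun σ ↦ (γ σ : E4)) t)‖ ≤ deriv (fun σ ↦ (γ σ : E4)) t 0 ∧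
      deriv (fun σ ↦ (γ σ : E4)) t 0 ≤ 7 := fun t ht ↦
    ray_far_bounds hM hopen hoc hgeo h0 hnull hE hE5 (hI ht) (hfarI t ht)
  have hdisp : ∀ t ∈ Icc 0 l₁, ∀ t' ∈ Icc 0 l₁, t ≤ t' →
      ‖E4.spatial (γ t' : E4) - E4.spatial (γ t : E4)‖ ≤ (γ t' : E4) 0 - (γ t : E4) 0 :=
    fun t ht t' ht' htt' ↦
      norm_spatial_sub_le_time_sub hIoc hder (fun u hu ↦ (hfb u hu).2.1) ht ht' htt'
  have htime : ∀ t ∈ Icc 0 l₁, ∀ t' ∈ Icc 0 l₁, t ≤ t' →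
      (γ t' : E4) 0 - (γ t : E4) 0 ≤ 7 * (t' - t) :=
    fun t ht t' ht' htt' ↦ time_sub_le_mul hIoc hder (fun u hu ↦ (hfb u hu).2.2) ht ht' htt'
  -- values at the start and at the exit
  have hstart0 : (γ 0 : E4) 0 = 0 := by
    rw [hγ0, Kerr.coe_sliceEmbed, E4.ofTimeSpace_apply_zero]
  have hstartsp : E4.spatial (γ 0 : E4) = (y : E3) := by
    rw [hγ0, Kerr.coe_sliceEmbed, E4.spatial_ofTimeSpace]
  have hρ1 : ‖E4.spatial (γ l₁ : E4)‖ ≤ 17 * M := by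
    have h := spatialNorm_sub_le_radius a (γ l₁ : E4)
    rw [hrl₁] at h
    change ‖E4.spatial (γ l₁ : E4)‖ - |a| ≤ 16 * M at h
    linarith [ha.le]
  have h0I : (0 : ℝ) ∈ Icc 0 l₁ := ⟨le_rfl, hl₁0.le⟩
  have hl₁I : l₁ ∈ Icc 0 l₁ := ⟨hl₁0.le, le_rfl⟩
  have hrev : ∀ t ∈ Icc 0 l₁, ‖(y : E3)‖ - ‖E4.spatial (γ t : E4)‖ ≤ (γ t : E4) 0 := by
    intro t ht
    have h1 := hdisp 0 h0I t ht ht.1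
    rw [hstartsp, hstart0, sub_zero] at h1
    have h2 : ‖(y : E3)‖ - ‖E4.spatial (γ t : E4)‖ ≤ ‖E4.spatial (γ t : E4) - (y : E3)‖ := by
      rw [norm_sub_rev]; exact norm_sub_norm_le _ _
    linarith
  -- the banking function
  set f : ℝ → ℝ := fun t ↦ (γ t : E4) 0 - 2 * ‖E4.spatial (γ t : E4)‖ + 14 * M with hf
  have hfcont : ContinuousOn f (Icc 0 l₁) := by
    intro t ht
    have hc := (hder t ht).continuousAt
    have h1 : ContinuousAt (fun σ ↦ (γ σ : E4) 0) t :=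
      ((EuclideanSpace.proj (0 : Fin 4) : E4 →L[ℝ] ℝ).continuous.continuousAt).comp hc
    have h2 : ContinuousAt (fun σ ↦ ‖E4.spatial (γ σ : E4)‖) t :=
      ((continuous_norm.comp E4.spatial.continuous).continuousAt).comp hc
    exact ((h1.sub (continuousAt_const.mul h2)).add continuousAt_const).continuousWithinAt
  have hf0 : f 0 < 0 := by
    have : f 0 = (γ 0 : E4) 0 - 2 * ‖(y : E3)‖ + 14 * M := by simp only [hf, hstartsp]
    rw [this, hstart0]
    linarith
  have hf1' : ‖(y : E3)‖ - 37 * M ≤ f l₁ := by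
    have h := hrev l₁ hl₁I
    simp only [hf]
    linarith
  have hf1 : 0 < f l₁ := by linarith
  obtain ⟨lₑ, hlₑ, hfe⟩ : ∃ lₑ ∈ Icc 0 l₁, f lₑ = 0 :=
    intermediate_value_Icc hl₁0.le hfcont ⟨hf0.le, hf1.le⟩
  have hfe' : (γ lₑ : E4) 0 - 2 * ‖E4.spatial (γ lₑ : E4)‖ + 14 * M = 0 := hfe
  -- at `lₑ` the ray is in the explicit region
  have hρe : 10 * M ≤ ‖E4.spatial (γ lₑ : E4)‖ := by
    have h := hrev lₑ hlₑ
    linarith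
  have hJe := flat_leaf_cone_mem_causalFuture ha hM (γ lₑ) hρe
    (by change 2 * ‖E4.spatial (γ lₑ : E4)‖ - 14 * M ≤ (γ lₑ : E4) 0; linarith)
  -- `J⁺` is hereditary along the ray on `[lₑ, l₁]`
  have hE0 : Kerr.bilin M a (γ 0) (deriv (fun σ ↦ (γ σ : E4)) 0) (E4.basisVector 0) ≠ 0 := by
    intro h; rw [h] at hE; simp at hE
  refine ⟨lₑ, hlₑ, ?_, fun t ht ↦ mem_causalFuture_of_le hM ht.1
    (ray_isFutureCausalCurveOn hM hopen hoc hgeo h0 hnull hfd hE0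
      (fun u hu ↦ hI ⟨hlₑ.1.trans hu.1, hu.2.trans ht.2⟩)) hJe⟩
  -- the length of the banked interval: `f l₁ ≤ 21 (l₁ − lₑ)`
  have h1 := htime lₑ hlₑ l₁ hl₁I hlₑ.2
  have h2 := hdisp lₑ hlₑ l₁ hl₁I hlₑ.2
  have h3 : ‖E4.spatial (γ lₑ : E4)‖ - ‖E4.spatial (γ l₁ : E4)‖ ≤
      ‖E4.spatial (γ l₁ : E4) - E4.spatial (γ lₑ : E4)‖ := by
    rw [norm_sub_rev]; exact norm_sub_norm_le _ _
  have h4 : f l₁ ≤ 21 * (l₁ - lₑ) := by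
    have : f l₁ = f l₁ - f lₑ := by rw [hfe, sub_zero]
    rw [this]
    simp only [hf]
    linarith
  linarith

end Main

end KerrFlatLeaf

open KerrFlatLeaf in
/-- **F1 `stub_kerrFlatLeafOptics` — sojourn optics of the ingoing Kerr–Schild chart `Kerr.region a M` seen
from the FLAT leaf `{t* = 0}`.** For `0 ≤ M`, `|a| < M`, and any future unit normal field `ν` of the slice
embedding `Kerr.sliceEmbed a M` (`y ↦ (0, y)`): for every `s > 0`, with `R₁ = 21 s + 53M + |a| + 1`, every
normalised future null ray `γ` of `Kerr.smoothMetric M a M` (maximal chart geodesic, `γ 0 = (0, y)`,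
`g(γ̇ 0, ν y) = −1`) from a slice point of Kerr–Schild radius `≥ R₁` is future complete in the chart
(`[0, ∞) ⊆ dom`) or spends affine time `≥ s` in `J⁺(sliceEmbed{8M ≤ ‖y′‖ ≤ 10M})`.  Conserved Killing
energy `0 < E ≤ 5` (`flat_energy_pos_le_five`), far bounds `0 < γ̇⁰ ≤ 7`, `|γ̇⃗| ≤ γ̇⁰` on `{r ≥ 16M}`,
escape lemma (`Ici_subset_of_far`, `M < r₊`), first exit from `{r > 16M}`, and banking of the sojourn through
the explicit region `{x⁰ ≥ 2‖x⃗‖ − 14M, ‖x⃗‖ ≥ 10M} ⊆ J⁺(sliceEmbed{8M ≤ ‖y′‖ ≤ 10M})` by the intermediate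
value theorem (`flat_exists_banked_interval`).  Dafermos–Rodnianski arXiv:0811.0354, §5.1; Christodoulou,
CQG 16 (1999) A23, pp. A26–A27. [cite: arXiv08110354, §5.1] -/
theorem stub_kerrFlatLeafOptics : ∀ [Kerr.Facts] (M a : ℝ) (hM : 0 ≤ M), |a| < M →
    ∀ (ν : NormalField 𝓘(ℝ, E4) (Kerr.sliceEmbed a M)),
    (Kerr.smoothMetric M a M).IsFutureUnitNormal 𝓘(ℝ, E3)
        ((Kerr.timeOrientation M a M hM).ofLE le_top) (Kerr.sliceEmbed a M) ν →
    ∀ [(Kerr.smoothMetric M a M).HasLeviCivita],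
    ∀ s : ℝ, 0 < s → ∃ R₁ : ℝ, ∀ y : Kerr.slice a M,
      R₁ ≤ Kerr.radius a (E4.ofTimeSpace 0 (y : E3)) →
      ∀ (γ : ℝ → Kerr.region a M) (dom : Set ℝ),
        (Kerr.smoothMetric M a M).IsNormalisedNullRayFrom
            ((Kerr.timeOrientation M a M hM).ofLE le_top) (Kerr.sliceEmbed a M) ν y γ dom →
        Set.Ici (0 : ℝ) ⊆ dom ∨
          ENNReal.ofReal s ≤ sojournTime γ dom
            ((Kerr.smoothMetric M a M).causalFuture ((Kerr.timeOrientation M a M hM).ofLE le_top)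
              (Kerr.sliceEmbed a M ''
                {y' : Kerr.slice a M | 8 * M ≤ ‖(y' : E3)‖ ∧ ‖(y' : E3)‖ ≤ 10 * M})) := by
  intro _ M a hM ha ν hν _ s hs
  have hMp := mass_pos ha
  refine ⟨21 * s + 53 * M + |a| + 1, fun y hy γ dom hray ↦ ?_⟩
  have hmax := hray.isMaximalGeodesicOn
  have hoc : dom.OrdConnected := hmax.2.1
  have h0 : (0 : ℝ) ∈ dom := hray.zero_mem
  have hγ0 : γ 0 = Kerr.sliceEmbed a M y := hray.apply_zero
  have hv0 : (velocity 𝓘(ℝ, E4) γ 0 : E4) = deriv (fun σ ↦ (γ σ : E4)) 0 :=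
    CollarCauchy.velocity_eq_deriv γ 0
  have hnull : Kerr.bilin M a (γ 0) (deriv (fun σ ↦ (γ σ : E4)) 0) (deriv (fun σ ↦ (γ σ : E4)) 0) = 0 := by
    have h : Kerr.bilin M a (γ 0) (velocity 𝓘(ℝ, E4) γ 0) (velocity 𝓘(ℝ, E4) γ 0) = 0 :=
      hray.isNull_velocity.1
    rwa [hv0] at h
  have hfd : 0 < deriv (fun σ ↦ (γ σ : E4)) 0 0 := by
    have h : Kerr.bilin M a (γ 0) (Kerr.timeVector M a (γ 0)) (velocity 𝓘(ℝ, E4) γ 0) < 0 :=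
      hray.isFutureDirected_velocity.2
    rw [Kerr.bilin_timeVector (Kerr.radius_pos_of_mem_region (γ 0).2), hv0] at h
    linarith
  have hnorm : Kerr.bilin M a (Kerr.sliceEmbed a M y) (deriv (fun σ ↦ (γ σ : E4)) 0) (ν y) = -1 := by
    have h : Kerr.bilin M a (Kerr.sliceEmbed a M y) (velocity 𝓘(ℝ, E4) γ 0) (ν y) = -1 :=
      hray.val_velocity_normal
    rwa [hv0] at h
  -- sizes at the start and the energy
  have hρy : Kerr.radius a (E4.ofTimeSpace 0 (y : E3)) ≤ ‖(y : E3)‖ :=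
    (Kerr.radius_le_spatialNorm a _).trans_eq (E4.spatialNorm_ofTimeSpace 0 _)
  have hy53 : 21 * s + 53 * M + |a| + 1 ≤ ‖(y : E3)‖ := hy.trans hρy
  have hs21 : 0 ≤ 21 * s := by positivity
  have hy16 : 16 * M + |a| + 1 ≤ ‖(y : E3)‖ := by linarith
  obtain ⟨hE, hE5⟩ := flat_energy_pos_le_five ha hM hν y hy16 (by rw [← hγ0]; exact hnull) hfd hnorm
  rw [← hγ0] at hE hE5
  by_cases hdom : Ici (0 : ℝ) ⊆ dom
  · exact Or.inl hdom
  right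
  -- an exit parameter from `{r ≥ 16M}`, and the first one
  obtain ⟨t₁, ht₁, ht₁0, hr₁⟩ : ∃ t₁ ∈ dom, 0 ≤ t₁ ∧ Kerr.radius a (γ t₁) < 16 * M := by
    by_contra hcon
    push Not at hcon
    exact hdom (Ici_subset_of_far ha hM (Kerr.IsSubextremal.M_lt_rPlus ha) hmax h0 hnull hE hE5
      fun t ht ht0 ↦ hcon t ht ht0)
  have hr0 : 16 * M < Kerr.radius a (γ 0) := by
    rw [hγ0, Kerr.coe_sliceEmbed]
    linarith [abs_nonneg a]
  obtain ⟨l₁, hl₁0, hI, hrl₁, hfarI⟩ :=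
    exists_first_exit hoc hmax.isGeodesicOn h0 hr0 ht₁ ht₁0 hr₁
  obtain ⟨lₑ, hlₑ, hlen, hJ⟩ := flat_exists_banked_interval ha hM hmax.isOpen hoc hmax.isGeodesicOn
    h0 hnull hfd hE hE5 hγ0 hs hy53 hl₁0 hI hrl₁ hfarI
  have hsub : Icc lₑ l₁ ⊆ {t ∈ dom | 0 ≤ t ∧ γ t ∈ (Kerr.smoothMetric M a M).causalFuture
      ((Kerr.timeOrientation M a M hM).ofLE le_top)
      (Kerr.sliceEmbed a M ''
        {y' : Kerr.slice a M | 8 * M ≤ ‖(y' : E3)‖ ∧ ‖(y' : E3)‖ ≤ 10 * M})} :=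
    fun t ht ↦ ⟨hI ⟨hlₑ.1.trans ht.1, ht.2⟩, hlₑ.1.trans ht.1, hJ t ht⟩
  calc ENNReal.ofReal s ≤ ENNReal.ofReal (l₁ - lₑ) := ENNReal.ofReal_le_ofReal hlen
    _ = volume (Icc lₑ l₁) := Real.volume_Icc.symm
    _ ≤ _ := measure_mono hsub

end Summit.FinalStateConjecture.FinalStateConjecture.Theorems.NearExtremalKappaCapture.UnitTemperatureFrontFace

end
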